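import Mathlib
import Summits.MatrixMultiplication.MatrixMultiplication.Theses.HiddenToeplitzCorners

/-!
# Crux `HiddenCorners` (stmt-MatrixMultiplication-7492) — line `Sketch`, lead's skeleton

Mechanism (diagnosed from the first r = 3 witness, evidence F13 of the crux item, and reproduced exactly in
the lead's folder): GAPPED TOEPLITZ SECTIONS WITH A MONOMIAL CORNER.  Fix integer vectors `α β : Fin r → ℤ`,
an offset `h`, and strictly increasing index maps `ρ γ : Fin N → ℤ` ("rows" and "columns", each a union of
few intervals: the positions where `ρ`/`γ` jump by more than one form the break sets `R₀`, `C₀`).  The pencil is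
`T a b = [ρ i − γ j = α a + β b]` (the bi-infinite Toeplitz operator of the symbol `Σ X_ab s^(α a + β b)` restricted
to rows `ρ`, columns `γ`).  If the columns contain the frame `γ (f c) = h − β c`, the rows contain the outputs
`ρ (o a) = h + α a`, and the rows AVOID every cross term `h + α a + β b − β c` (`b ≠ c`), then
`T(X) E = F X` with unit-vector frames (`stub_gapped_corner`), so `T(X)` is singular on singular `X`
(`stub_corner_singular` = support `CornerCriterion`); the sections are Toeplitz-like with split Stein
generators of length `d = max(#R₀, #C₀)` and generator sparsity `≤ 4·d·r²` (`stub_gapped_generators`).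
What is left is purely combinatorial + one determinant: a FAMILY of designs with `≤ r^ε` breaks,
`N ≤ r^(2+ε)`, and `det T(X₀) ≠ 0` for some `X₀` (`stub_family`, the hardest stub, held by the lead).
`stub_witness_r3` is the (r, N, d) = (3, 7, 2) instance as a stand-alone certificate (cf. `ToeplitzCornerTwo`).

`HiddenCorners_of` composes the stubs into the crux BY NAME and is sorry-free.
-/

set_option linter.dupNamespace false

namespace Summit.MatrixMultiplication.MatrixMultiplication.Cruxes.HiddenCorners.Sketch

open Summit.MatrixMultiplication.MatrixMultiplication.Theses.HiddenToeplitzCorners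
open scoped BigOperators Matrix

/-- STUB 1 — the corner criterion, literally the route's support decl `CornerCriterion` (stmt-7494):
a rank-`r` frame `E` with `T(X) E = F X` carries a kernel vector of a singular `X` to one of `T(X)`. -/
theorem stub_corner_singular : CornerCriterion := by
  sorry

/-- STUB 2 — gapped Toeplitz sections are Toeplitz-like with short, sparse split Stein generators.
For strictly monotone-by-steps index maps `ρ`, `γ` whose breaks lie in `R₀`, `C₀` (both containing index 0,
both of size `≤ d`), the 0/1 pencil `T a b i j = [ρ i − γ j = α a + β b]` satisfies the crux's displacement
identity with `G₀`, `H₀` = unit vectors at the breaks, and the X-dependent generators have at most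
`4·d` nonzero entries per `(a, b)`. -/
theorem stub_gapped_generators (r N d : ℕ) (ρ γ : Fin N → ℤ) (α β : Fin r → ℤ)
    (R₀ C₀ : Finset (Fin N)) (hR : R₀.card ≤ d) (hC : C₀.card ≤ d)
    (h0R : ∀ i : Fin N, (i : ℕ) = 0 → i ∈ R₀) (h0C : ∀ j : Fin N, (j : ℕ) = 0 → j ∈ C₀)
    (hstepR : ∀ i i' : Fin N, (i : ℕ) = i' + 1 → i ∉ R₀ → ρ i = ρ i' + 1)
    (hstepC : ∀ j j' : Fin N, (j : ℕ) = j' + 1 → j ∉ C₀ → γ j = γ j' + 1)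
    (hρ : Function.Injective ρ) (hγ : Function.Injective γ) :
    ∃ (G₀ H₀ : Matrix (Fin N) (Fin d) ℂ) (G₁ H₁ : Fin r → Fin r → Matrix (Fin N) (Fin d) ℂ),
      (∀ a b : Fin r,
        (Matrix.of fun i j : Fin N => if ρ i - γ j = α a + β b then (1 : ℂ) else 0)
          - (Matrix.of fun i j : Fin N => if (i : ℕ) = (j : ℕ) + 1 then (1 : ℂ) else 0)
            * (Matrix.of fun i j : Fin N => if ρ i - γ j = α a + β b then (1 : ℂ) else 0)
            * (Matrix.of fun i j : Fin N => if (i : ℕ) = (j : ℕ) + 1 then (1 : ℂ) else 0)ᵀ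
          = G₀ * (H₁ a b)ᵀ + G₁ a b * H₀ᵀ) ∧
      (∑ a : Fin r, ∑ b : Fin r,
          ((Finset.univ.filter fun p : Fin N × Fin d => G₁ a b p.1 p.2 ≠ 0).card
            + (Finset.univ.filter fun p : Fin N × Fin d => H₁ a b p.1 p.2 ≠ 0).card) : ℕ)
        ≤ 4 * d * r ^ 2 := by
  sorry

/-- STUB 3 — the monomial corner of a gapped design.  If the columns contain the frame positions
`γ (f c) = h − β c` (`f` injective), the rows contain the outputs `ρ (o a) = h + α a`, and no row index is a
cross term `h + α a + β b − β c` with `b ≠ c`, then `T(X) E = F X` for unit-vector frames `E` (rank `r`), `F`. -/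
theorem stub_gapped_corner (r N : ℕ) (ρ γ : Fin N → ℤ) (α β : Fin r → ℤ) (h : ℤ)
    (f o : Fin r → Fin N) (hρ : Function.Injective ρ) (hf : Function.Injective f)
    (hfγ : ∀ c, γ (f c) = h - β c) (hoρ : ∀ a, ρ (o a) = h + α a)
    (hforb : ∀ (i : Fin N) (a b c : Fin r), b ≠ c → ρ i ≠ h + α a + β b - β c) :
    ∃ E F : Matrix (Fin N) (Fin r) ℂ, E.rank = r ∧ ∀ X : Matrix (Fin r) (Fin r) ℂ,
      (∑ a : Fin r, ∑ b : Fin r,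
          X a b • (Matrix.of fun i j : Fin N => if ρ i - γ j = α a + β b then (1 : ℂ) else 0)) * E
        = F * X := by
  sorry

/-- STUB 4-OLD (DEAD as of 2026-08-16: needs d ≥ (r+1)/6, see Negative-notes/monomial-gapped-corners.md; kept
registered so the disprover can land its negation; NOT used by `HiddenCorners_of` any more; formerly: the lead's) — the design FAMILY: for every `ε > 0` and infinitely many `r`, a gapped
design with at most `d ≤ r^ε` row breaks and column breaks, `N ≤ r^(2+ε)` indices, generator sparsity budget
`4·d·r² ≤ r^(2+ε)`, the frame/output/forbidden-row conditions of `stub_gapped_corner`, and ONE matrix `X₀` at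
which the section is nonsingular. -/
theorem stub_family : ∀ ε : ℝ, 0 < ε → ∃ᶠ r : ℕ in Filter.atTop, ∃ (N d : ℕ),
    (N : ℝ) ≤ (r : ℝ) ^ (2 + ε) ∧ (d : ℝ) ≤ (r : ℝ) ^ ε ∧ (4 * d * r ^ 2 : ℝ) ≤ (r : ℝ) ^ (2 + ε) ∧
    ∃ (ρ γ : Fin N → ℤ) (α β : Fin r → ℤ) (h : ℤ) (f o : Fin r → Fin N) (R₀ C₀ : Finset (Fin N)),
      Function.Injective ρ ∧ Function.Injective γ ∧ Function.Injective f ∧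
      (∀ c, γ (f c) = h - β c) ∧ (∀ a, ρ (o a) = h + α a) ∧
      (∀ (i : Fin N) (a b c : Fin r), b ≠ c → ρ i ≠ h + α a + β b - β c) ∧
      R₀.card ≤ d ∧ C₀.card ≤ d ∧
      (∀ i : Fin N, (i : ℕ) = 0 → i ∈ R₀) ∧ (∀ j : Fin N, (j : ℕ) = 0 → j ∈ C₀) ∧
      (∀ i i' : Fin N, (i : ℕ) = i' + 1 → i ∉ R₀ → ρ i = ρ i' + 1) ∧
      (∀ j j' : Fin N, (j : ℕ) = j' + 1 → j ∉ C₀ → γ j = γ j' + 1) ∧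
      ∃ X₀ : Matrix (Fin r) (Fin r) ℂ,
        (∑ a : Fin r, ∑ b : Fin r,
            X₀ a b • (Matrix.of fun i j : Fin N => if ρ i - γ j = α a + β b then (1 : ℂ) else 0)).det ≠ 0 := by
  sorry

/-- STUB 4a (general bookkeeping, supersedes STUB 2 for non-monomial symbols) — PIECEWISE-TOEPLITZ pencils with
sparse rows/columns have short sparse split Stein generators.  If every `T a b` is constant along diagonals except at the
break rows `R₀` / break columns `C₀` (both containing index 0, both of size `≤ d`) and has at most `s` nonzero entries in
each row and each column, then the crux's displacement identity holds with `G₀`, `H₀` = unit vectors at the breaks and the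
X-dependent generators have at most `4·d·s` nonzero entries per `(a, b)`. -/
theorem stub_piecewise_generators (r N d s : ℕ) (T : Fin r → Fin r → Matrix (Fin N) (Fin N) ℂ)
    (R₀ C₀ : Finset (Fin N)) (hR : R₀.card ≤ d) (hC : C₀.card ≤ d)
    (h0R : ∀ i : Fin N, (i : ℕ) = 0 → i ∈ R₀) (h0C : ∀ j : Fin N, (j : ℕ) = 0 → j ∈ C₀)
    (hT : ∀ (a b : Fin r) (i j i' j' : Fin N), (i : ℕ) = i' + 1 → (j : ℕ) = j' + 1 → i ∉ R₀ → j ∉ C₀ →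
      T a b i j = T a b i' j')
    (hrow : ∀ (a b : Fin r) (i : Fin N), (Finset.univ.filter fun j : Fin N => T a b i j ≠ 0).card ≤ s)
    (hcol : ∀ (a b : Fin r) (j : Fin N), (Finset.univ.filter fun i : Fin N => T a b i j ≠ 0).card ≤ s) :
    ∃ (G₀ H₀ : Matrix (Fin N) (Fin d) ℂ) (G₁ H₁ : Fin r → Fin r → Matrix (Fin N) (Fin d) ℂ),
      (∀ a b : Fin r,
        T a b - (Matrix.of fun i j : Fin N => if (i : ℕ) = (j : ℕ) + 1 then (1 : ℂ) else 0) * T a b *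
            (Matrix.of fun i j : Fin N => if (i : ℕ) = (j : ℕ) + 1 then (1 : ℂ) else 0)ᵀ
          = G₀ * (H₁ a b)ᵀ + G₁ a b * H₀ᵀ) ∧
      (∑ a : Fin r, ∑ b : Fin r,
          ((Finset.univ.filter fun p : Fin N × Fin d => G₁ a b p.1 p.2 ≠ 0).card
            + (Finset.univ.filter fun p : Fin N × Fin d => H₁ a b p.1 p.2 ≠ 0).card) : ℕ)
        ≤ 4 * d * s * r ^ 2 := by
  sorry

/-- STUB 4b (hardest; the lead's; RESHAPED 2026-08-16 after the monomial family `stub_family` was shown to need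
`d ≥ (r+1)/6` breaks by a Hall-type count, Negative-notes/monomial-gapped-corners.md) — the DENSE-FRAME family:
for every `ε > 0` and infinitely many `r`, a piecewise-Toeplitz pencil with `≤ d ≤ r^ε` row/column breaks, rows and
columns of sparsity `≤ s` with `4·d·s·r² ≤ r^(2+ε)`, `N ≤ r^(2+ε)`, SOME rank-`r` corner `T(X) E = F X` (frames arbitrary,
not necessarily unit vectors), and one nonsingular value `T(X₀)`.  Its truth at `d ≤ r^ε` contradicts the negative crux
`HiddenCornerLemmaR` (stmt-10752) asymptotically; instances exist at r = 3, d = 2 with dense LEFT frames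
(lead's exp/border1_diag.py). -/
theorem stub_family_dense : ∀ ε : ℝ, 0 < ε → ∃ᶠ r : ℕ in Filter.atTop, ∃ (N d s : ℕ),
    (N : ℝ) ≤ (r : ℝ) ^ (2 + ε) ∧ (d : ℝ) ≤ (r : ℝ) ^ ε ∧ (4 * d * s * r ^ 2 : ℝ) ≤ (r : ℝ) ^ (2 + ε) ∧
    ∃ (T : Fin r → Fin r → Matrix (Fin N) (Fin N) ℂ) (R₀ C₀ : Finset (Fin N)),
      R₀.card ≤ d ∧ C₀.card ≤ d ∧
      (∀ i : Fin N, (i : ℕ) = 0 → i ∈ R₀) ∧ (∀ j : Fin N, (j : ℕ) = 0 → j ∈ C₀) ∧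
      (∀ (a b : Fin r) (i j i' j' : Fin N), (i : ℕ) = i' + 1 → (j : ℕ) = j' + 1 → i ∉ R₀ → j ∉ C₀ →
        T a b i j = T a b i' j') ∧
      (∀ (a b : Fin r) (i : Fin N), (Finset.univ.filter fun j : Fin N => T a b i j ≠ 0).card ≤ s) ∧
      (∀ (a b : Fin r) (j : Fin N), (Finset.univ.filter fun i : Fin N => T a b i j ≠ 0).card ≤ s) ∧
      (∃ E F : Matrix (Fin N) (Fin r) ℂ, E.rank = r ∧
        ∀ X : Matrix (Fin r) (Fin r) ℂ, (∑ a : Fin r, ∑ b : Fin r, X a b • T a b) * E = F * X) ∧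
      ∃ X₀ : Matrix (Fin r) (Fin r) ℂ, (∑ a : Fin r, ∑ b : Fin r, X₀ a b • T a b).det ≠ 0 := by
  sorry

/-- STUB 5 — the smallest instance as a stand-alone certificate, (r, N, d) = (3, 7, 2): rows `[−2, 4]`,
columns `{−10} ∪ [−5, 0]`, symbol `t_(a + 5 b) = X a b` (lead's exp/search_gapped.py; cf. `ToeplitzCornerTwo`
at (2, 4, 1)).  Split generators of length 2, rank-3 unit frames with `T(X) E = F X`, `det T(X₀) ≠ 0`, and
singular on every singular `X`. -/
theorem stub_witness_r3 : ∃ (T : Fin 3 → Fin 3 → Matrix (Fin 7) (Fin 7) ℂ),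
    (∃ (G₀ H₀ : Matrix (Fin 7) (Fin 2) ℂ) (G₁ H₁ : Fin 3 → Fin 3 → Matrix (Fin 7) (Fin 2) ℂ),
      ∀ a b, T a b - (Matrix.of fun i j : Fin 7 => if (i : ℕ) = (j : ℕ) + 1 then (1 : ℂ) else 0) * T a b *
        (Matrix.of fun i j : Fin 7 => if (i : ℕ) = (j : ℕ) + 1 then (1 : ℂ) else 0)ᵀ
          = G₀ * (H₁ a b)ᵀ + G₁ a b * H₀ᵀ) ∧
    (∃ E F : Matrix (Fin 7) (Fin 3) ℂ, E.rank = 3 ∧ F.rank = 3 ∧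
      ∀ X : Matrix (Fin 3) (Fin 3) ℂ, (∑ a : Fin 3, ∑ b : Fin 3, X a b • T a b) * E = F * X) ∧
    (∃ X₀ : Matrix (Fin 3) (Fin 3) ℂ, (∑ a : Fin 3, ∑ b : Fin 3, X₀ a b • T a b).det ≠ 0) ∧
    ∀ X : Matrix (Fin 3) (Fin 3) ℂ, X.det = 0 → (∑ a : Fin 3, ∑ b : Fin 3, X a b • T a b).det = 0 := by
  sorry

/-- COMPOSITION (sorry-free): the dense-frame family stub, the piecewise-Toeplitz bookkeeping stub and the corner
criterion give the crux `HiddenCorners` by name.  (The monomial stubs `stub_gapped_generators`, `stub_gapped_corner`,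
`stub_family`, `stub_witness_r3` remain as registered supporting statements; the first composition, through
`stub_family`, is recorded in Lines/Sketch.dead-monomial note and is no longer the line.) -/
theorem HiddenCorners_of : HiddenCorners := by
  intro ε hε
  refine (stub_family_dense ε hε).mono ?_
  rintro r ⟨N, d, s, hN, hd, hds, T, R₀, C₀, hR, hC, h0R, h0C, hT, hrow, hcol, ⟨E, F, hE, hcorner⟩, X₀, hX₀⟩
  obtain ⟨G₀, H₀, G₁, H₁, hdisp, hsp⟩ :=
    stub_piecewise_generators r N d s T R₀ C₀ hR hC h0R h0C hT hrow hcol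
  refine ⟨N, d, hN, hd, T, G₀, H₀, G₁, H₁, hdisp, ?_, ⟨X₀, hX₀⟩, ?_⟩
  · calc ((∑ a : Fin r, ∑ b : Fin r,
          ((Finset.univ.filter fun p : Fin N × Fin d => G₁ a b p.1 p.2 ≠ 0).card
            + (Finset.univ.filter fun p : Fin N × Fin d => H₁ a b p.1 p.2 ≠ 0).card) : ℕ) : ℝ)
        ≤ ((4 * d * s * r ^ 2 : ℕ) : ℝ) := by exact_mod_cast hsp
      _ = 4 * d * s * r ^ 2 := by push_cast; ring
      _ ≤ (r : ℝ) ^ (2 + ε) := hds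
  · intro X hX
    exact stub_corner_singular r N T E F hE hcorner X hX

/-- The first (monomial) composition, kept so that the monomial stubs stay connected: the registered monomial
family stub `stub_family` (now known to be FALSE — Negative-notes/monomial-gapped-corners.md) would also give the
crux, through `stub_gapped_generators`, `stub_gapped_corner` and `stub_corner_singular`. -/
theorem HiddenCorners_of_monomial_family : HiddenCorners := by
  intro ε hε
  refine (stub_family ε hε).mono ?_
  rintro r ⟨N, d, hN, hd, hd4, ρ, γ, α, β, h, f, o, R₀, C₀, hρ, hγ, hf, hfγ, hoρ, hforb, hR, hC,
    h0R, h0C, hstepR, hstepC, X₀, hX₀⟩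
  obtain ⟨G₀, H₀, G₁, H₁, hdisp, hsp⟩ :=
    stub_gapped_generators r N d ρ γ α β R₀ C₀ hR hC h0R h0C hstepR hstepC hρ hγ
  obtain ⟨E, F, hE, hcorner⟩ := stub_gapped_corner r N ρ γ α β h f o hρ hf hfγ hoρ hforb
  refine ⟨N, d, hN, hd, _, G₀, H₀, G₁, H₁, hdisp, ?_, ⟨X₀, hX₀⟩, ?_⟩
  · calc ((∑ a : Fin r, ∑ b : Fin r,
          ((Finset.univ.filter fun p : Fin N × Fin d => G₁ a b p.1 p.2 ≠ 0).card
            + (Finset.univ.filter fun p : Fin N × Fin d => H₁ a b p.1 p.2 ≠ 0).card) : ℕ) : ℝ)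
        ≤ ((4 * d * r ^ 2 : ℕ) : ℝ) := by exact_mod_cast hsp
      _ = 4 * d * r ^ 2 := by push_cast; ring
      _ ≤ (r : ℝ) ^ (2 + ε) := hd4
  · intro X hX
    exact stub_corner_singular r N _ E F hE hcorner X hX

end Summit.MatrixMultiplication.MatrixMultiplication.Cruxes.HiddenCorners.Sketch
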